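import Summits.KontsevichZagierPeriods.KontsevichZagierPeriods.Theorems.MultiplicationAccessible.Negative.Core
import Summits.KontsevichZagierPeriods.KontsevichZagierPeriods.Theorems.TerasomaMultiplicationMultiplicationAccessibleStubStripBridge
import Summits.KontsevichZagierPeriods.KontsevichZagierPeriods.Theorems.TerasomaMultiplicationMultiplicationAccessibleStubBetaReassoc
import Summits.KontsevichZagierPeriods.KontsevichZagierPeriods.Theorems.TerasomaMultiplicationMultiplicationAccessibleStubDirichletSimplex
import Summits.KontsevichZagierPeriods.KontsevichZagierPeriods.Theorems.TerasomaMultiplicationMultiplicationAccessibleStubDupSymmetrise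
import Summits.KontsevichZagierPeriods.KontsevichZagierPeriods.Theorems.TerasomaMultiplicationMultiplicationAccessibleStubDupPhi
import Summits.KontsevichZagierPeriods.KontsevichZagierPeriods.Theorems.TerasomaMultiplicationMultiplicationAccessibleStubGlueFromParts
import Summits.KontsevichZagierPeriods.KontsevichZagierPeriods.Theorems.TerasomaMultiplicationMultiplicationAccessibleStubMultiplicativityGlueAux4

/-!
# `MultiplicationAccessible` (stmt-KontsevichZagierPeriods-12305), line `shifted-family-prime-sieve`:
the SIEVE — Gauss multiplication inside the Kontsevich–Zagier rules at every `n = 2^k`, and the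
reduction of the whole crux to the shifted family at odd primes

The crux (route TerasomaMultiplication, rank 3): for `m ≥ 1` (`n = m + 1`) and rational `s > 0` the
box representation `[(0,1)^m, ∏ᵢ xᵢ^((i+1)/n − 1)(1 − xᵢ)^(s−1)]` of `∏_(k=1)^m B(k/n, s)` and the big
simplex representation `[{σ > 0, Σσ < n}, (∏σⱼ·(n − Σσⱼ))^(s−1)]` of `n^(ns−1)Γ(s)^n/Γ(ns)` are
equivalent under the moves of Kontsevich–Zagier (2001, §1.2).

The line works with the two-parameter SHIFTED family, written out in full below (no definition is
introduced): "`GM(m; x, s)`" says that every box representation of `∏_(k<n) B(x + k/n, s)`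
(integrand `∏ₖ zₖ^(x + k/n − 1)(1 − zₖ)^(s−1)` on `(0,1)^n`) is equivalent to every box
representation of `n^(ns) B(nx, ns) ∏_(j=1)^(n−1) B(js, s)` (Gauss's multiplication formula in
shifted Beta form, Andrews–Askey–Roy 1999 Thm 1.5.2). With the seven landed stubs of the line
(imported above) this file proves, sorry-free and with no named fact:

* `gm_zero`, `gm_one` — the family at `n = 1` (empty) and `n = 2` (Legendre duplication for all
  exponents: `stub_dupSymmetrise` + `stub_dupPhi`, the latter ONE change of variables along the
  rational bijection `Φ(η₀,η₁) = (η₀η₁, (1−η₀)(1+η₁)/(2(1−η₀η₁)))` of the open box);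
* `gm_glue` — multiplicativity in `n` (`stub_multiplicativityGlue_part4` + `stub_glueFromParts` +
  `stub_betaReassoc`), hence `gm_two_pow` — the family at every `n = 2^k`;
* `multiplicationAccessible_at_of_gm` — the bridge at `x = 1/n` (`stub_stripBridge` +
  `stub_dirichletSimplex`): `GM(m; 1/n, s)` implies the crux instance `(m, s)`;
* **`multiplicationAccessible_at_two_pow`** — the crux instance at every `m` with `m + 1 = 2^k`
  and every rational `s > 0`: the first composite Gauss multiplications inside the calculus
  (`n = 4, 8, 16, …`; `n = 2` was the route item `DuplicationAllExponents`);
* **`multiplicationAccessible_of_gm_odd_primes`** — the whole crux from the shifted family at the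
  odd primes `p` (all rational `x, s > 0`), by strong induction over `Nat.minFac`.

The residual — the shifted family at an odd prime — is the registered stub `stub_oddPrimeShifted`
of the line and is NOT claimed here (no chain of moves is known at any odd prime; at `p = 3`,
`x = 1/3` it contains the open crux `MultiplicationThree`). References: Kontsevich–Zagier 2001
§1.2; Andrews–Askey–Roy 1999, Thm 1.5.2 (Gauss multiplication), Thm 1.8.1 (Dirichlet).
-/

noncomputable section

open MeasureTheory Set
open Literature.NumberTheory.Transcendental
open Literature.NumberTheory.Transcendental.KZ
open Summit.KontsevichZagierPeriods.KontsevichZagierPeriods.Theses.TerasomaMultiplication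
  (MultiplicationAccessible)
open Summit.KontsevichZagierPeriods.MultiplicationAccessible.Negative (multiplicationAccessible_iff)

namespace Summit.KontsevichZagierPeriods.TerasomaMultiplication.MultiplicationAccessible

/-- `GM(0; x, s)` (`n = 1`) is the empty statement `B(x,s) = 1^s B(x,s)`: both integrands agree on
the box (congruence, `KZ.of_sub_of_mem_relations_of_eqOn`). [folklore] -/
theorem gm_zero :
    (∀ (x s : ℚ), 0 < x → 0 < s → ∀ (r r' : IntegralRep (0 + 1)),
        r.domain = {z | ∀ i, z i ∈ Set.Ioo (0:ℝ) 1} →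
        Set.EqOn r.integrand (fun z => ∏ k : Fin (0 + 1),
          (z k) ^ ((x:ℝ) + ((k:ℕ):ℝ) / (((0:ℕ):ℝ) + 1) - 1) * (1 - z k) ^ ((s:ℝ) - 1)) r.domain →
        r'.domain = {z | ∀ i, z i ∈ Set.Ioo (0:ℝ) 1} →
        Set.EqOn r'.integrand (fun z => (((0:ℕ):ℝ) + 1) ^ ((((0:ℕ):ℝ) + 1) * (s:ℝ)) *
          ((z 0) ^ ((((0:ℕ):ℝ) + 1) * (x:ℝ) - 1) * (1 - z 0) ^ ((((0:ℕ):ℝ) + 1) * (s:ℝ) - 1)) *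
          ∏ j : Fin 0, (z j.succ) ^ ((((j:ℕ):ℝ) + 1) * (s:ℝ) - 1) * (1 - z j.succ) ^ ((s:ℝ) - 1))
          r'.domain →
        Equivalent r r') := by
  intro x s _ _ r r' hr hri hr' hri'
  refine of_sub_of_mem_relations_of_eqOn (by rw [hr, hr']) fun z hz => ?_
  have hz' : z ∈ r'.domain := by rw [hr', ← hr]; exact hz
  rw [hri hz, hri' hz']
  norm_num [Fin.prod_univ_one]
  rw [Fin.prod_univ_one]

/-- The integrand of `GM(1; x, s)` on the left, written out on `(0,1)²`. [folklore] -/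
theorem gmLeft_one_eq (x s : ℚ) (z : Fin 2 → ℝ) :
    (∏ k : Fin (1 + 1), (z k) ^ ((x:ℝ) + ((k:ℕ):ℝ) / (((1:ℕ):ℝ) + 1) - 1) *
        (1 - z k) ^ ((s:ℝ) - 1)) =
      (z 0) ^ ((x:ℝ) - 1) * (1 - z 0) ^ ((s:ℝ) - 1) *
        ((z 1) ^ ((x:ℝ) - 1/2) * (1 - z 1) ^ ((s:ℝ) - 1)) := by
  rw [Fin.prod_univ_two]
  have h0 : ((x:ℝ) + (((0 : Fin (1 + 1)) : ℕ):ℝ) / (((1:ℕ):ℝ) + 1) - 1) = (x:ℝ) - 1 := by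
    norm_num
  have h1 : ((x:ℝ) + (((1 : Fin (1 + 1)) : ℕ):ℝ) / (((1:ℕ):ℝ) + 1) - 1) = (x:ℝ) - 1/2 := by
    norm_num; ring
  rw [h0, h1]

/-- The integrand of `GM(1; x, s)` on the right, written out on `(0,1)²` (`2^(2s) = 4^s`).
[folklore] -/
theorem gmRight_one_eq (x s : ℚ) (z : Fin 2 → ℝ) :
    (((1:ℕ):ℝ) + 1) ^ ((((1:ℕ):ℝ) + 1) * (s:ℝ)) *
        ((z 0) ^ ((((1:ℕ):ℝ) + 1) * (x:ℝ) - 1) * (1 - z 0) ^ ((((1:ℕ):ℝ) + 1) * (s:ℝ) - 1)) *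
        ∏ j : Fin 1, (z j.succ) ^ ((((j:ℕ):ℝ) + 1) * (s:ℝ) - 1) * (1 - z j.succ) ^ ((s:ℝ) - 1) =
      (4:ℝ) ^ (s:ℝ) * (z 0) ^ (2 * (x:ℝ) - 1) * (1 - z 0) ^ (2 * (s:ℝ) - 1) *
        ((z 1) ^ ((s:ℝ) - 1) * (1 - z 1) ^ ((s:ℝ) - 1)) := by
  have h4 : ((2:ℝ)) ^ ((2:ℝ) * (s:ℝ)) = (4:ℝ) ^ (s:ℝ) := by
    rw [Real.rpow_mul (by norm_num : (0:ℝ) ≤ 2)]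
    norm_num
  rw [Fin.prod_univ_one]
  have e6 : (((1:ℕ):ℝ) + 1) = (2:ℝ) := by norm_num
  have e7 : ((((0 : Fin 1) : ℕ):ℝ) + 1) = (1:ℝ) := by norm_num
  have e8 : ((0 : Fin 1).succ : Fin (1 + 1)) = 1 := rfl
  simp only [e6, e7, e8, one_mul, h4]
  ring

/-- **`GM(1; x, s)` for all positive rational `x, s`** — Legendre duplication in shifted form,
`B(x,s)B(x+½,s) = 4^s B(2x,2s)B(s,s)`, inside the rules: the symmetrised Kummer pull-back
(`stub_dupSymmetrise`) followed by ONE change of variables along the bijection `Φ` of the open box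
(`stub_dupPhi`). [cite: AndrewsAskeyRoy1999, Thm 1.5.2] -/
theorem gm_one :
    (∀ (x s : ℚ), 0 < x → 0 < s → ∀ (r r' : IntegralRep (1 + 1)),
        r.domain = {z | ∀ i, z i ∈ Set.Ioo (0:ℝ) 1} →
        Set.EqOn r.integrand (fun z => ∏ k : Fin (1 + 1),
          (z k) ^ ((x:ℝ) + ((k:ℕ):ℝ) / (((1:ℕ):ℝ) + 1) - 1) * (1 - z k) ^ ((s:ℝ) - 1)) r.domain →
        r'.domain = {z | ∀ i, z i ∈ Set.Ioo (0:ℝ) 1} →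
        Set.EqOn r'.integrand (fun z => (((1:ℕ):ℝ) + 1) ^ ((((1:ℕ):ℝ) + 1) * (s:ℝ)) *
          ((z 0) ^ ((((1:ℕ):ℝ) + 1) * (x:ℝ) - 1) * (1 - z 0) ^ ((((1:ℕ):ℝ) + 1) * (s:ℝ) - 1)) *
          ∏ j : Fin 1, (z j.succ) ^ ((((j:ℕ):ℝ) + 1) * (s:ℝ) - 1) * (1 - z j.succ) ^ ((s:ℝ) - 1))
          r'.domain →
        Equivalent r r') := by
  intro x s hx hs r r' hr hri hr' hri'
  have hri₂ : Set.EqOn r.integrand (fun z => (z 0) ^ ((x:ℝ) - 1) * (1 - z 0) ^ ((s:ℝ) - 1) *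
      ((z 1) ^ ((x:ℝ) - 1/2) * (1 - z 1) ^ ((s:ℝ) - 1))) r.domain := fun z hz => by
    rw [hri hz]
    exact gmLeft_one_eq x s z
  have hri₂' : Set.EqOn r'.integrand (fun z => (4:ℝ) ^ (s:ℝ) * (z 0) ^ (2 * (x:ℝ) - 1) *
      (1 - z 0) ^ (2 * (s:ℝ) - 1) * ((z 1) ^ ((s:ℝ) - 1) * (1 - z 1) ^ ((s:ℝ) - 1)))
      r'.domain := fun z hz => by
    rw [hri' hz]
    exact gmRight_one_eq x s z
  obtain ⟨q, hqd, hqi, hrq⟩ := stub_dupSymmetrise x s hx hs r hr hri₂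
  exact hrq.trans (stub_dupPhi x s hx hs q r' hqd hqi hr' hri₂')

/-- **Multiplicativity of the shifted family in `n`**: `GM` at `n₁ = a + 1` and at `n₂ = b + 1`
(all `x, s`) give `GM` at `n = n₁ n₂ = (a*b + a + b) + 1` — block re-indexing, `GM(n₁)` per residue
block, `GM(n₂)` on the block heads, the caterpillar re-association; cancellation-free
(`stub_multiplicativityGlue_part4` in the formal period ring, `stub_glueFromParts` for the pinned
forms, `stub_betaReassoc` = Dirichlet's re-association as two changes of variables).
[cite: AndrewsAskeyRoy1999, Thm 1.5.2] -/
theorem gm_glue (a b : ℕ)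
    (ha : (∀ (x s : ℚ), 0 < x → 0 < s → ∀ (r r' : IntegralRep (a + 1)),
        r.domain = {z | ∀ i, z i ∈ Set.Ioo (0:ℝ) 1} →
        Set.EqOn r.integrand (fun z => ∏ k : Fin (a + 1),
          (z k) ^ ((x:ℝ) + ((k:ℕ):ℝ) / ((a:ℝ) + 1) - 1) * (1 - z k) ^ ((s:ℝ) - 1)) r.domain →
        r'.domain = {z | ∀ i, z i ∈ Set.Ioo (0:ℝ) 1} →
        Set.EqOn r'.integrand (fun z => ((a:ℝ) + 1) ^ (((a:ℝ) + 1) * (s:ℝ)) *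
          ((z 0) ^ (((a:ℝ) + 1) * (x:ℝ) - 1) * (1 - z 0) ^ (((a:ℝ) + 1) * (s:ℝ) - 1)) *
          ∏ j : Fin a, (z j.succ) ^ ((((j:ℕ):ℝ) + 1) * (s:ℝ) - 1) * (1 - z j.succ) ^ ((s:ℝ) - 1))
          r'.domain →
        Equivalent r r'))
    (hb : (∀ (x s : ℚ), 0 < x → 0 < s → ∀ (r r' : IntegralRep (b + 1)),
        r.domain = {z | ∀ i, z i ∈ Set.Ioo (0:ℝ) 1} →
        Set.EqOn r.integrand (fun z => ∏ k : Fin (b + 1),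
          (z k) ^ ((x:ℝ) + ((k:ℕ):ℝ) / ((b:ℝ) + 1) - 1) * (1 - z k) ^ ((s:ℝ) - 1)) r.domain →
        r'.domain = {z | ∀ i, z i ∈ Set.Ioo (0:ℝ) 1} →
        Set.EqOn r'.integrand (fun z => ((b:ℝ) + 1) ^ (((b:ℝ) + 1) * (s:ℝ)) *
          ((z 0) ^ (((b:ℝ) + 1) * (x:ℝ) - 1) * (1 - z 0) ^ (((b:ℝ) + 1) * (s:ℝ) - 1)) *
          ∏ j : Fin b, (z j.succ) ^ ((((j:ℕ):ℝ) + 1) * (s:ℝ) - 1) * (1 - z j.succ) ^ ((s:ℝ) - 1))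
          r'.domain →
        Equivalent r r')) :
    (∀ (x s : ℚ), 0 < x → 0 < s → ∀ (r r' : IntegralRep (a * b + a + b + 1)),
        r.domain = {z | ∀ i, z i ∈ Set.Ioo (0:ℝ) 1} →
        Set.EqOn r.integrand (fun z => ∏ k : Fin (a * b + a + b + 1),
          (z k) ^ ((x:ℝ) + ((k:ℕ):ℝ) / (((a * b + a + b : ℕ):ℝ) + 1) - 1) * (1 - z k) ^ ((s:ℝ) - 1)) r.domain →
        r'.domain = {z | ∀ i, z i ∈ Set.Ioo (0:ℝ) 1} →
        Set.EqOn r'.integrand (fun z => (((a * b + a + b : ℕ):ℝ) + 1) ^ ((((a * b + a + b : ℕ):ℝ) + 1) * (s:ℝ)) *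
          ((z 0) ^ ((((a * b + a + b : ℕ):ℝ) + 1) * (x:ℝ) - 1) * (1 - z 0) ^ ((((a * b + a + b : ℕ):ℝ) + 1) * (s:ℝ) - 1)) *
          ∏ j : Fin (a * b + a + b), (z j.succ) ^ ((((j:ℕ):ℝ) + 1) * (s:ℝ) - 1) * (1 - z j.succ) ^ ((s:ℝ) - 1))
          r'.domain →
        Equivalent r r') :=
  stub_glueFromParts a b ha hb (stub_multiplicativityGlue_part4 stub_betaReassoc a b)

/-- **The shifted family at every `n = 2^k`**: `GM(m; x, s)` whenever `m + 1 = 2^k`, by induction on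
`k` (`2^(k+1) = 2·2^k`, i.e. `m = 1*m₀ + 1 + m₀` with `m₀ + 1 = 2^k`). [cite: AndrewsAskeyRoy1999, Thm 1.5.2] -/
theorem gm_two_pow : ∀ (k m : ℕ), m + 1 = 2 ^ k →
    (∀ (x s : ℚ), 0 < x → 0 < s → ∀ (r r' : IntegralRep (m + 1)),
        r.domain = {z | ∀ i, z i ∈ Set.Ioo (0:ℝ) 1} →
        Set.EqOn r.integrand (fun z => ∏ k : Fin (m + 1),
          (z k) ^ ((x:ℝ) + ((k:ℕ):ℝ) / ((m:ℝ) + 1) - 1) * (1 - z k) ^ ((s:ℝ) - 1)) r.domain →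
        r'.domain = {z | ∀ i, z i ∈ Set.Ioo (0:ℝ) 1} →
        Set.EqOn r'.integrand (fun z => ((m:ℝ) + 1) ^ (((m:ℝ) + 1) * (s:ℝ)) *
          ((z 0) ^ (((m:ℝ) + 1) * (x:ℝ) - 1) * (1 - z 0) ^ (((m:ℝ) + 1) * (s:ℝ) - 1)) *
          ∏ j : Fin m, (z j.succ) ^ ((((j:ℕ):ℝ) + 1) * (s:ℝ) - 1) * (1 - z j.succ) ^ ((s:ℝ) - 1))
          r'.domain →
        Equivalent r r') := by
  intro k
  induction k with
  | zero =>
    intro m hm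
    have : m = 0 := by simpa using hm
    subst this
    exact gm_zero
  | succ k ih =>
    intro m hm
    obtain ⟨m₀, hm₀⟩ : ∃ m₀, m₀ + 1 = 2 ^ k := ⟨2 ^ k - 1, Nat.sub_add_cancel Nat.one_le_two_pow⟩
    have hm' : 1 * m₀ + 1 + m₀ = m := by
      have : m + 1 = 2 * (m₀ + 1) := by rw [hm, hm₀, pow_succ, mul_comm]
      omega
    rw [← hm']
    exact gm_glue 1 m₀ gm_one (ih m₀ hm₀)

/-- **The bridge at `x = 1/n`**: `GM(m; 1/(m+1), s)` implies the crux instance `(m, s)` — strip the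
two value-`1/s` factors by Newton–Leibniz moves and rescale (`stub_stripBridge`), then convert the
Beta box `[(0,1)^m, n^(ns−1) ∏ⱼ zⱼ^((j+1)s−1)(1−zⱼ)^(s−1)]` into the big simplex by the Dirichlet
chart (`stub_dirichletSimplex`). [cite: AndrewsAskeyRoy1999, Thm 1.8.1] -/
theorem multiplicationAccessible_at_of_gm (m : ℕ) (s : ℚ) (hm : 1 ≤ m) (hs : 0 < s)
    (hGM : (∀ (r r' : IntegralRep (m + 1)),
        r.domain = {z | ∀ i, z i ∈ Set.Ioo (0:ℝ) 1} →
        Set.EqOn r.integrand (fun z => ∏ k : Fin (m + 1),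
          (z k) ^ ((((1 / ((m:ℚ) + 1) : ℚ)):ℝ) + ((k:ℕ):ℝ) / ((m:ℝ) + 1) - 1) * (1 - z k) ^ ((s:ℝ) - 1)) r.domain →
        r'.domain = {z | ∀ i, z i ∈ Set.Ioo (0:ℝ) 1} →
        Set.EqOn r'.integrand (fun z => ((m:ℝ) + 1) ^ (((m:ℝ) + 1) * (s:ℝ)) *
          ((z 0) ^ (((m:ℝ) + 1) * (((1 / ((m:ℚ) + 1) : ℚ)):ℝ) - 1) * (1 - z 0) ^ (((m:ℝ) + 1) * (s:ℝ) - 1)) *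
          ∏ j : Fin m, (z j.succ) ^ ((((j:ℕ):ℝ) + 1) * (s:ℝ) - 1) * (1 - z j.succ) ^ ((s:ℝ) - 1))
          r'.domain →
        Equivalent r r')) :
    ∀ (r r' : IntegralRep m),
      r.domain = {x | ∀ i, x i ∈ Set.Ioo (0:ℝ) 1} →
      Set.EqOn r.integrand (fun x => ∏ i : Fin m,
        (x i) ^ ((((i:ℕ):ℝ) + 1) / ((m:ℝ) + 1) - 1) * (1 - x i) ^ ((s:ℝ) - 1)) r.domain →
      r'.domain = {x | (∀ i, 0 < x i) ∧ ∑ i, x i < (m:ℝ) + 1} →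
      Set.EqOn r'.integrand
        (fun x => ((∏ i, x i) * ((m:ℝ) + 1 - ∑ i, x i)) ^ ((s:ℝ) - 1)) r'.domain →
      Equivalent r r' := by
  intro r r' hr hri hr' hri'
  obtain ⟨q, hqd, hqi, hrq⟩ := stub_stripBridge m s hm hs hGM r hr hri
  exact hrq.trans (stub_dirichletSimplex m s hm hs q r' hqd hqi hr' hri')

/-- **Gauss multiplication inside the Kontsevich–Zagier rules at every `n = 2^k`**: for every `m`
with `m + 1 = 2^k`, `m ≥ 1`, and every rational `s > 0`, the box representation of
`∏_(i=1)^m B(i/n, s)` and the big simplex representation of `n^(ns−1)Γ(s)^n/Γ(ns)` are equivalent —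
the instances `n = 4, 8, 16, …` of the crux `MultiplicationAccessible`, with no unproved input.
[cite: AndrewsAskeyRoy1999, Thm 1.5.2] -/
theorem multiplicationAccessible_at_two_pow :
    ∀ (k m : ℕ), m + 1 = 2 ^ k → 1 ≤ m → ∀ (s : ℚ), 0 < s → ∀ (r r' : KZ.IntegralRep m),
      r.domain = {x | ∀ i, x i ∈ Set.Ioo (0:ℝ) 1} →
      Set.EqOn r.integrand (fun x => ∏ i : Fin m,
        (x i) ^ ((((i:ℕ):ℝ) + 1) / ((m:ℝ) + 1) - 1) * (1 - x i) ^ ((s:ℝ) - 1)) r.domain →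
      r'.domain = {x | (∀ i, 0 < x i) ∧ ∑ i, x i < (m:ℝ) + 1} →
      Set.EqOn r'.integrand
        (fun x => ((∏ i, x i) * ((m:ℝ) + 1 - ∑ i, x i)) ^ ((s:ℝ) - 1)) r'.domain →
      KZ.Equivalent r r' :=
  fun k m hk hm s hs =>
    multiplicationAccessible_at_of_gm m s hm hs
      (gm_two_pow k m hk (1 / ((m:ℚ) + 1)) s (by positivity) hs)

/-- **The crux from the shifted family at the odd primes.** If `GM(p−1; x, s)` holds for every odd
prime `p` and all rational `x, s > 0` (the registered stub `stub_oddPrimeShifted` of the line —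
hypothesis `hprime`; no chain is known at any odd prime), then `MultiplicationAccessible` holds:
`GM(m; x, s)` for every `m` by strong induction on the factorisation of `m + 1` (`Nat.minFac`:
`n = 2` by `gm_one`, odd primes by hypothesis, composites by `gm_glue`), then the bridge at
`x = 1/n` and `Negative.multiplicationAccessible_iff`. [cite: AndrewsAskeyRoy1999, Thm 1.5.2] -/
theorem multiplicationAccessible_of_gm_odd_primes :
    (∀ p : ℕ, p.Prime → 3 ≤ p →
      (∀ (x s : ℚ), 0 < x → 0 < s → ∀ (r r' : KZ.IntegralRep (p - 1 + 1)),
          r.domain = {z | ∀ i, z i ∈ Set.Ioo (0:ℝ) 1} →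
          Set.EqOn r.integrand (fun z => ∏ k : Fin (p - 1 + 1),
            (z k) ^ ((x:ℝ) + ((k:ℕ):ℝ) / (((p - 1 : ℕ):ℝ) + 1) - 1) * (1 - z k) ^ ((s:ℝ) - 1)) r.domain →
          r'.domain = {z | ∀ i, z i ∈ Set.Ioo (0:ℝ) 1} →
          Set.EqOn r'.integrand (fun z => (((p - 1 : ℕ):ℝ) + 1) ^ ((((p - 1 : ℕ):ℝ) + 1) * (s:ℝ)) *
            ((z 0) ^ ((((p - 1 : ℕ):ℝ) + 1) * (x:ℝ) - 1) * (1 - z 0) ^ ((((p - 1 : ℕ):ℝ) + 1) * (s:ℝ) - 1)) *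
            ∏ j : Fin (p - 1), (z j.succ) ^ ((((j:ℕ):ℝ) + 1) * (s:ℝ) - 1) * (1 - z j.succ) ^ ((s:ℝ) - 1))
            r'.domain →
          KZ.Equivalent r r')) →
      Summit.KontsevichZagierPeriods.KontsevichZagierPeriods.Theses.TerasomaMultiplication.MultiplicationAccessible := by
  intro hprime
  have gm_all : ∀ m : ℕ,
      (∀ (x s : ℚ), 0 < x → 0 < s → ∀ (r r' : IntegralRep (m + 1)),
          r.domain = {z | ∀ i, z i ∈ Set.Ioo (0:ℝ) 1} →
          Set.EqOn r.integrand (fun z => ∏ k : Fin (m + 1),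
            (z k) ^ ((x:ℝ) + ((k:ℕ):ℝ) / ((m:ℝ) + 1) - 1) * (1 - z k) ^ ((s:ℝ) - 1)) r.domain →
          r'.domain = {z | ∀ i, z i ∈ Set.Ioo (0:ℝ) 1} →
          Set.EqOn r'.integrand (fun z => ((m:ℝ) + 1) ^ (((m:ℝ) + 1) * (s:ℝ)) *
            ((z 0) ^ (((m:ℝ) + 1) * (x:ℝ) - 1) * (1 - z 0) ^ (((m:ℝ) + 1) * (s:ℝ) - 1)) *
            ∏ j : Fin m, (z j.succ) ^ ((((j:ℕ):ℝ) + 1) * (s:ℝ) - 1) * (1 - z j.succ) ^ ((s:ℝ) - 1))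
            r'.domain →
          Equivalent r r') := by
    intro m
    induction m using Nat.strong_induction_on with
    | _ m ih =>
      rcases Nat.eq_zero_or_pos m with rfl | hm
      · exact gm_zero
      by_cases hpr : (m + 1).Prime
      · by_cases h2 : m + 1 = 2
        · have : m = 1 := by omega
          subst this
          exact gm_one
        · have h3 : 3 ≤ m + 1 := by
            have := hpr.two_le
            omega
          exact hprime (m + 1) hpr h3
      · obtain ⟨p, hp⟩ : ∃ p, p = (m + 1).minFac := ⟨_, rfl⟩
        have hpprime : p.Prime := hp ▸ Nat.minFac_prime (by omega)
        have hpdvd : p ∣ m + 1 := hp ▸ Nat.minFac_dvd (m + 1)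
        obtain ⟨q, hq⟩ := hpdvd
        have hp2 : 2 ≤ p := hpprime.two_le
        have hq0 : q ≠ 0 := by
          rintro rfl
          simp at hq
        have hq1 : q ≠ 1 := by
          rintro rfl
          rw [mul_one] at hq
          exact hpr (hq ▸ hpprime)
        have hq2 : 2 ≤ q := by omega
        have hpn : p < m + 1 := by
          rw [hq]
          exact lt_mul_of_one_lt_right (by omega) (by omega)
        have hqn : q < m + 1 := by
          rw [hq]
          exact lt_mul_of_one_lt_left (by omega) (by omega)
        have hpm : p - 1 < m := by omega
        have hqm : q - 1 < m := by omega
        have hm' : (p - 1) * (q - 1) + (p - 1) + (q - 1) = m := by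
          have h1 : (p - 1) * (q - 1) + (p - 1) + (q - 1) + 1 = p * q := by
            cases p with
            | zero => omega
            | succ p' =>
              cases q with
              | zero => omega
              | succ q' => simp; ring
          omega
        have ha := ih (p - 1) hpm
        have hb := ih (q - 1) hqm
        rw [← hm']
        exact gm_glue (p - 1) (q - 1) ha hb
  rw [multiplicationAccessible_iff]
  intro m s hm hs r r' hr hr'
  have hx : (0:ℚ) < 1 / ((m:ℚ) + 1) := by positivity
  exact multiplicationAccessible_at_of_gm m s hm hs (gm_all m _ s hx hs) r r' hr.1 hr.2 hr'.1 hr'.2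

end Summit.KontsevichZagierPeriods.TerasomaMultiplication.MultiplicationAccessible

end
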